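import Mathlib.GroupTheory.Transfer
import HarnessLib

/-!
# Route `PrintCf2`, crux stmt-BirchSwinnertonDyer-20509 `RamifiedOffTYZOfFacts` — THE TRANSFER IDENTITY FOR GENUS PERIODS
# (cell `bsd-print-cf2`, LEAD of 20509 g4, line `offtyz-v7`, lineage cycle 5; pure group theory, fact-free, Theses-free, no `def` of
# `def`)

HONEST FRAMING.  Tian–Yuan–Zhang (2017, §3.1, chunk p0011 of paper:arxiv-1411.4728) define the genus period/point
`Z(n) := Σ_{t ∈ Φ₀} z_n^t` of the CM value `z_n ∈ A(H′_n)` over a set `Φ₀` of REPRESENTATIVES of `2Cl′_n/⟨σ⟩ ≅ Gal(H_n/L_n)`,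
where `σ` generates `Gal(H′_n/H_n)` and moves `z_n` by the 2-torsion point `τ(1)` (Thm. 3.6); p0020 L36–L45 records the
consequence «`Z(n)^α − Z(n) ∈ ℤτ(1)` for `α ∈ 2Cl′_n`».  The LEAD note `Cruxes/RamifiedOffTYZOfFacts/Lines/offtyz_v7_TransferLayer.md`
(cycle 5) sharpens this to an EXACT formula — `α·Z(n) = Z(n) + [Ver(α) = σ]·τ(1)` with `Ver` the transfer `Gal(H′_n/L_n) → Gal(H′_n/H_n)`,
which for these ABELIAN groups is the power map `α ↦ α^{g(n)}` — and one level up (`z_n = (1−i)·w`, `w ∈ A(H_{n,4})`) to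
`g·W̃ = W̃ + c(g^{g(n)})`.  THIS FILE is the abstract algebra behind both statements, kernel-checked:

* `(∑ q : G ⧸ A, ((T.2.leftQuotientEquiv q : G) • w)) = Σ_{q ∈ G/A} t_q • w` for a commutative group `G` acting on an additive group `M`, a finite-index subgroup
  `A ≤ G`, a left transversal `T = {t_q}` and a point `w` (§1);
* §2 `sum_transversal_smul_eq_add_diff`: for a second transversal `S`, `Σ_q s_q • w = W + toAdd (diff c T S)` as soon as
  `A` moves `w` by a translation cocycle `c : A →* Multiplicative M` with `G`-fixed values — the bookkeeping step;
* §3 **`smul_genusPeriod_eq_add_transfer`**: `g • W = W + c(transfer g)` and, by Mathlib's `MonoidHom.transfer_eq_pow`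
  (transfer into a central subgroup is the power map), **`smul_genusPeriod_eq_add_pow_index`: `g • W = W + c(g ^ [G : A])`**;
  corollaries: `W` is `G`-fixed iff `c` kills every `g ^ [G:A]` (`smul_genusPeriod_eq_self_iff`), in particular whenever
  `g ^ [G:A] = 1` for all `g` (`smul_genusPeriod_eq_self_of_pow_index_eq_one`).

What this buys the line (LEAD census, crux 20509): the first two `(1+i)`-adic digits of the depth of TYZ's genus period over the
genus field are values of a transfer = power map in the ring class groups of conductor `2` and `4` (note §3–§4: trichotomy and
𝔭₂-law), NOT beyond-print objects; the typed number theory (Prop. 3.2 / Thm. 3.6 / Prop. 3.8 of TYZ as displays) that would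
instantiate `G, A, w, c` is specified in the note §8 and is typer work.  Beyond-print theorem: NO (group theory).  BSD is not
proved by any of this; no class is closed by this file.

References: [cite: TianYuanZhang2017, §3.1 (p0011 L58–L66), Thm. 3.6 (p0012), proof of Thm. 3.5 (2) (p0020 L27–L45)];
Mathlib `Mathlib.GroupTheory.Transfer` (`MonoidHom.transfer_def`, `MonoidHom.transfer_eq_pow`); the g4 note (crux dir).
-/

noncomputable section

open scoped Pointwise

open Subgroup Subgroup.leftTransversals MulAction

namespace Summit.BirchSwinnertonDyer.PrintCf2.GenusPeriodTransfer

variable {G : Type*} [CommGroup G] (A : Subgroup G) [A.FiniteIndex] [Fintype (G ⧸ A)]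
variable {M : Type*} [AddCommGroup M] [DistribMulAction G M]

/-! ## §1 The genus period attached to a transversal -/

/- The «genus period» of `w` along a left transversal `T = {t_q}_{q ∈ G/A}` of `A` in `G` is written out in full below as
`∑ q : G ⧸ A, ((T.2.leftQuotientEquiv q : G) • w)` (TYZ's `Z(n) = Σ_{t∈Φ₀} z_n^t`, resp. `W̃ = Σ t̃·w` of the LEAD note); no
definition is introduced (proof-only helper file). -/

/-! ## §2 Changing the transversal costs the `diff`-cocycle -/

/-- **Bookkeeping step.** If every `a ∈ A` moves `w` by the translation `c a` (a homomorphism `c : A →* Multiplicative M`)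
and the values of `c` are fixed by `G`, then summing `w` along ANOTHER transversal `S = {s_q}` gives the genus period along `T`
plus `diff c T S = ∏_q c(t_q⁻¹ s_q)` (Mathlib's difference of transversals), read additively. [folklore] -/
theorem sum_transversal_smul_eq_add_diff (T S : A.LeftTransversal) (w : M) (c : A →* Multiplicative M)
    (hc : ∀ a : A, (a : G) • w = w + Multiplicative.toAdd (c a))
    (hfix : ∀ (g : G) (a : A), g • Multiplicative.toAdd (c a) = Multiplicative.toAdd (c a)) :
    ∑ q : G ⧸ A, ((S.2.leftQuotientEquiv q : G) • w) =
      (∑ q : G ⧸ A, ((T.2.leftQuotientEquiv q : G) • w)) + Multiplicative.toAdd (diff c T S) := by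
  have hmem : ∀ q : G ⧸ A, ((T.2.leftQuotientEquiv q : G))⁻¹ * (S.2.leftQuotientEquiv q : G) ∈ A := fun q =>
    QuotientGroup.leftRel_apply.mp <|
      Quotient.exact' ((T.2.leftQuotientEquiv.symm_apply_apply q).trans
        (S.2.leftQuotientEquiv.symm_apply_apply q).symm)
  -- Mathlib's `diff` carries its own `Fintype (G ⧸ A)` instance; all such instances agree.
  have hdiff : Multiplicative.toAdd (diff c T S) =
      ∑ q : G ⧸ A, Multiplicative.toAdd (c ⟨_, hmem q⟩) := by
    unfold diff
    dsimp only
    rw [← toAdd_prod]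
    congr 1
    exact Finset.prod_congr (congrArg (@Finset.univ (G ⧸ A)) (Subsingleton.elim _ _)) (fun _ _ => rfl)
  rw [hdiff, ← Finset.sum_add_distrib]
  refine Finset.sum_congr rfl fun q _ => ?_
  have e : (S.2.leftQuotientEquiv q : G) =
      (T.2.leftQuotientEquiv q : G) * ((⟨_, hmem q⟩ : A) : G) := by
    simp only [mul_inv_cancel_left]
  conv_lhs => rw [e, mul_smul, hc ⟨_, hmem q⟩, smul_add, hfix]

/-! ## §3 The Galois action on the genus period is the transfer, i.e. the power map -/

/-- **`g • W = W + c(transfer g)`.** Acting by `g ∈ G` on the genus period replaces the transversal `T` by `g • T`; the cost is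
`diff c T (g • T) = transfer c g` (Mathlib `MonoidHom.transfer_def`). [folklore] -/
theorem smul_genusPeriod_eq_add_transfer (T : A.LeftTransversal) (w : M) (c : A →* Multiplicative M)
    (hc : ∀ a : A, (a : G) • w = w + Multiplicative.toAdd (c a))
    (hfix : ∀ (g : G) (a : A), g • Multiplicative.toAdd (c a) = Multiplicative.toAdd (c a)) (g : G) :
    g • (∑ q : G ⧸ A, ((T.2.leftQuotientEquiv q : G) • w)) = (∑ q : G ⧸ A, ((T.2.leftQuotientEquiv q : G) • w)) + Multiplicative.toAdd (MonoidHom.transfer c g) := by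
  rw [MonoidHom.transfer_def c T g, ← sum_transversal_smul_eq_add_diff A T (g • T) w c hc hfix]
  rw [Finset.smul_sum]
  -- reindex the sum by `q ↦ g • q` and use `g • t_q = (g • T)_{g • q}`
  refine (Fintype.sum_equiv (MulAction.toPerm g) _ _ fun q => ?_)
  rw [MulAction.toPerm_apply, ← smul_leftQuotientEquiv g T q, smul_eq_mul, mul_smul]

/-- **THE TRANSFER IDENTITY: `g • W = W + c(g ^ [G:A])`.**  Since `G` is commutative, the transfer `G → A` is the power map
`g ↦ g ^ [G:A]` (Mathlib `MonoidHom.transfer_eq_pow`), so the Galois action on the genus period is read off ONE power.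
In TYZ's setting (`G = Gal(H′_n/L_n) = 2Cl′_n`, `A = Gal(H′_n/H_n) = ⟨σ⟩`, `[G:A] = g(n)`, `c(σ) = τ(1)`) this is
`α·Z(n) = Z(n) + [α^{g(n)} = σ]·τ(1)`; one level up (`G = Gal(H_{n,4}/L_n)`, `A = Gal(H_{n,4}/H_n) ≅ A[2]`) it is
`g·W̃ = W̃ + c(g^{g(n)})` (LEAD note, Thm. B). [folklore] -/
theorem smul_genusPeriod_eq_add_pow_index (T : A.LeftTransversal) (w : M) (c : A →* Multiplicative M)
    (hc : ∀ a : A, (a : G) • w = w + Multiplicative.toAdd (c a))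
    (hfix : ∀ (g : G) (a : A), g • Multiplicative.toAdd (c a) = Multiplicative.toAdd (c a)) (g : G) :
    g • (∑ q : G ⧸ A, ((T.2.leftQuotientEquiv q : G) • w)) =
      (∑ q : G ⧸ A, ((T.2.leftQuotientEquiv q : G) • w)) + Multiplicative.toAdd (c ⟨g ^ A.index, A.pow_index_mem g⟩) := by
  have key : ∀ (k : ℕ) (g₀ : G), g₀⁻¹ * g ^ k * g₀ ∈ A → g₀⁻¹ * g ^ k * g₀ = g ^ k := by
    intro k g₀ _
    rw [mul_comm (g₀⁻¹), mul_assoc, inv_mul_cancel, mul_one]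
  rw [smul_genusPeriod_eq_add_transfer A T w c hc hfix g, MonoidHom.transfer_eq_pow c g key]

/-- `W` is fixed by `g` iff the translation cocycle kills `g ^ [G:A]`. [folklore] -/
theorem smul_genusPeriod_eq_self_iff (T : A.LeftTransversal) (w : M) (c : A →* Multiplicative M)
    (hc : ∀ a : A, (a : G) • w = w + Multiplicative.toAdd (c a))
    (hfix : ∀ (g : G) (a : A), g • Multiplicative.toAdd (c a) = Multiplicative.toAdd (c a)) (g : G) :
    g • (∑ q : G ⧸ A, ((T.2.leftQuotientEquiv q : G) • w)) = (∑ q : G ⧸ A, ((T.2.leftQuotientEquiv q : G) • w)) ↔ c ⟨g ^ A.index, A.pow_index_mem g⟩ = 1 := by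
  rw [smul_genusPeriod_eq_add_pow_index A T w c hc hfix g, add_eq_left]
  constructor
  · intro h
    exact toAdd_eq_zero.mp h
  · intro h
    rw [h, toAdd_one]

/-- If every `[G:A]`-th power is trivial (e.g. the 2-part of `G` does not extend the quotient cyclically far enough — the
«both layers vanish» case of the LEAD note's trichotomy), the genus period is `G`-invariant. [folklore] -/
theorem smul_genusPeriod_eq_self_of_pow_index_eq_one (T : A.LeftTransversal) (w : M) (c : A →* Multiplicative M)
    (hc : ∀ a : A, (a : G) • w = w + Multiplicative.toAdd (c a))
    (hfix : ∀ (g : G) (a : A), g • Multiplicative.toAdd (c a) = Multiplicative.toAdd (c a))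
    (hpow : ∀ g : G, g ^ A.index = 1) (g : G) :
    g • (∑ q : G ⧸ A, ((T.2.leftQuotientEquiv q : G) • w)) = (∑ q : G ⧸ A, ((T.2.leftQuotientEquiv q : G) • w)) := by
  rw [smul_genusPeriod_eq_self_iff A T w c hc hfix g]
  have h1 : (⟨g ^ A.index, A.pow_index_mem g⟩ : A) = 1 := Subtype.ext (hpow g)
  rw [h1, map_one]

/-- Conversely, an element whose `[G:A]`-th power is NOT killed by the cocycle MOVES the genus period (the «Layer fires» case:
`α^{g(n)} = σ` ⟹ `α·Z(n) = Z(n) + τ(1) ≠ Z(n)`). [folklore] -/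
theorem smul_genusPeriod_ne_self_of_ne_one (T : A.LeftTransversal) (w : M) (c : A →* Multiplicative M)
    (hc : ∀ a : A, (a : G) • w = w + Multiplicative.toAdd (c a))
    (hfix : ∀ (g : G) (a : A), g • Multiplicative.toAdd (c a) = Multiplicative.toAdd (c a)) (g : G)
    (hg : c ⟨g ^ A.index, A.pow_index_mem g⟩ ≠ 1) :
    g • (∑ q : G ⧸ A, ((T.2.leftQuotientEquiv q : G) • w)) ≠ (∑ q : G ⧸ A, ((T.2.leftQuotientEquiv q : G) • w)) := by
  rw [Ne, smul_genusPeriod_eq_self_iff A T w c hc hfix g]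
  exact hg

end Summit.BirchSwinnertonDyer.PrintCf2.GenusPeriodTransfer

end
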